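import Mathlib
import HarnessLib
import Summits.ResolutionOfSingularities.ResolutionOfSingularities.Theorems.WildQuotientsWildQuotientResolutionS1aA1Move3Cover

/-!
# S1a — INSTANCE I-3 (D₄), MOVE 4 (THE KILL): the σ-fixed degree-0 cover of `B₊(s₃, W′, s)` and `hrad`

[OURS · L1 W4.5c · lead-1 g13; plan-1 RULING R-F15e, X-CERT v1.1 §2 / v1.2-D4ROWS move 4 (three producer charts ALL KILLED), NOTES `D4 TREE OF RECORD`] — NOT
statements of the manuscript; counted 0; AI-level work, weaker than expert review. Crux stmt-ResolutionOfSingularities-17941 `CyclicQuotientFourfolds`, line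
`s1a-logminvertex` v13 (`stub_reachLowerInFX`). Pure commutative algebra on the abstract model `Q` of the node of the `[Y]₂` chart (rows as in ✓`…S1aD4Move4Ring`).

Unlike ✓`…S1aA1Move3Cover` the degree bookkeeping is ABSTRACTED: the three raw cover elements are `b₀ = s₃^{2ep}·U₀`, `b₁ = N₄^{2e}·U₁`
(`N₄ = ∏_{i : ZMod p} (W′ + i·s²tY′s₃) = ∏ σⁱ(W′)`), `b₂ = s^{ep}·U₂` with `U₀, U₁, U₂` ARBITRARY `τ`-fixed units (chosen in the leaf so that each `b_j` has degree
0 — hypotheses `hb_jd`), all in `𝒥_{2ep}`; the cover in degree `d₄·2ep` is `y_j = b_j^{d₄}`: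
* `d4m4_norm_mem/_fixed/_deg/_T`, `d4m4_b_mem`, `d4m4_y_mem`, `d4m4_y_fixed`, `d4m4_y_deg`, `d4m4_raw_coe`;
* ★ `d4m4_hrad` — `s₃T, W′T, sT² ∈ √(c₀, c₁, c₂)` for `c_j = y_jT^{d₄·2ep}`: the three charts cover `B₊`.
(«Every cover element lies in `𝔞₄`» is immediate from ✓`d4m4_residual_mem` + ✓`OneShotKill.coverElement_mem_span_u'` in the move theorem.)
-/

set_option linter.dupNamespace false

noncomputable section

open Literature.AlgebraicGeometry.Resolution
open scoped LaurentPolynomial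
open Summit.ResolutionOfSingularities.ResolutionOfSingularities.Theorems.WildQuotientResolution.S1.CoarseChart
open Summit.ResolutionOfSingularities.ResolutionOfSingularities.Theorems.WildQuotientResolution.S1.BlowupCharts
open Summit.ResolutionOfSingularities.ResolutionOfSingularities.Theorems.WildQuotientResolution.S1.KillCert.A1

namespace Summit.ResolutionOfSingularities.ResolutionOfSingularities.Theorems.WildQuotientResolution.S1.KillCert.D4

variable {Q : Type} [CommRing Q] (τ : Q ≃+* Q) (t s Y' W' s₃ U₀ U₁ U₂ : Q)
  (ht : τ t = t) (hs : τ s = s) (hY' : τ Y' = Y') (hs₃ : τ s₃ = s₃) (hW' : τ W' = W' + s ^ 2 * t * Y' * s₃)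
  (hU₀ : τ U₀ = U₀) (hU₁ : τ U₁ = U₁) (hU₂ : τ U₂ = U₂) {p : ℕ} (e d₄ : ℕ)

/-! ## Filtration levels -/

/-- `N₄ = ∏ (W′ + i·s²tY′s₃) ∈ 𝒥_p`. -/
theorem d4m4_norm_mem [NeZero p] :
    (∏ i : ZMod p, (W' + (i.val : Q) * (s ^ 2 * t * Y' * s₃))) ∈ (weightedFiltration (![s₃, W', s] : Fin 3 → Q) ![1, 1, 2]).ideal p := by
  have h1 : ∀ i : ZMod p, W' + (i.val : Q) * (s ^ 2 * t * Y' * s₃) ∈ (weightedFiltration (![s₃, W', s] : Fin 3 → Q) ![1, 1, 2]).ideal 1 := fun i =>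
    add_mem (mem_weightedFiltration_ideal (![s₃, W', s] : Fin 3 → Q) ![1, 1, 2] 1)
      (Ideal.mul_mem_left _ _ (Ideal.mul_mem_left _ _ (mem_weightedFiltration_ideal (![s₃, W', s] : Fin 3 → Q) ![1, 1, 2] 0)))
  have := Ideal.prod_mem_prod (s := (Finset.univ : Finset (ZMod p))) (fun i _ => h1 i)
  rw [Finset.prod_const, Finset.card_univ, ZMod.card] at this
  have hle := Veronese.idealFiltration_pow_le (weightedFiltration (![s₃, W', s] : Fin 3 → Q) ![1, 1, 2]) 1 p
  rw [one_mul] at hle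
  exact hle this

/-- The raw cover elements `b₀ = s₃^{2ep}U₀`, `b₁ = N₄^{2e}U₁`, `b₂ = s^{ep}U₂` lie in `𝒥_{2ep}`. -/
theorem d4m4_b_mem [NeZero p] :
    s₃ ^ (2 * (e * p)) * U₀ ∈ (weightedFiltration (![s₃, W', s] : Fin 3 → Q) ![1, 1, 2]).ideal (2 * (e * p)) ∧
    (∏ i : ZMod p, (W' + (i.val : Q) * (s ^ 2 * t * Y' * s₃))) ^ (2 * e) * U₁ ∈ (weightedFiltration (![s₃, W', s] : Fin 3 → Q) ![1, 1, 2]).ideal (2 * (e * p)) ∧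
    s ^ (e * p) * U₂ ∈ (weightedFiltration (![s₃, W', s] : Fin 3 → Q) ![1, 1, 2]).ideal (2 * (e * p)) := by
  refine ⟨Ideal.mul_mem_right _ _ ?_, Ideal.mul_mem_right _ _ ?_, Ideal.mul_mem_right _ _ ?_⟩
  · have h := Ideal.pow_mem_pow (mem_weightedFiltration_ideal (![s₃, W', s] : Fin 3 → Q) ![1, 1, 2] 0) (2 * (e * p))
    have hle := Veronese.idealFiltration_pow_le (weightedFiltration (![s₃, W', s] : Fin 3 → Q) ![1, 1, 2]) 1 (2 * (e * p))
    rw [one_mul] at hle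
    exact hle h
  · have h := Ideal.pow_mem_pow (d4m4_norm_mem t s Y' W' s₃ (p := p)) (2 * e)
    have hle := Veronese.idealFiltration_pow_le (weightedFiltration (![s₃, W', s] : Fin 3 → Q) ![1, 1, 2]) p (2 * e)
    rw [show p * (2 * e) = 2 * (e * p) by ring] at hle
    exact hle h
  · have h := Ideal.pow_mem_pow (mem_weightedFiltration_ideal (![s₃, W', s] : Fin 3 → Q) ![1, 1, 2] 2) (e * p)
    have hle := Veronese.idealFiltration_pow_le (weightedFiltration (![s₃, W', s] : Fin 3 → Q) ![1, 1, 2]) 2 (e * p)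
    exact hle h

/-- **The cover in degree `d₄·2ep`**: `y_j = b_j^{d₄} ∈ 𝒥_{d₄·2ep}`. -/
theorem d4m4_y_mem [NeZero p] :
    (s₃ ^ (2 * (e * p)) * U₀) ^ d₄ ∈ (weightedFiltration (![s₃, W', s] : Fin 3 → Q) ![1, 1, 2]).ideal (d₄ * (2 * (e * p))) ∧
    ((∏ i : ZMod p, (W' + (i.val : Q) * (s ^ 2 * t * Y' * s₃))) ^ (2 * e) * U₁) ^ d₄ ∈
      (weightedFiltration (![s₃, W', s] : Fin 3 → Q) ![1, 1, 2]).ideal (d₄ * (2 * (e * p))) ∧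
    (s ^ (e * p) * U₂) ^ d₄ ∈ (weightedFiltration (![s₃, W', s] : Fin 3 → Q) ![1, 1, 2]).ideal (d₄ * (2 * (e * p))) := by
  obtain ⟨h0, h1, h2⟩ := d4m4_b_mem t s Y' W' s₃ U₀ U₁ U₂ (p := p) e
  have hle := Veronese.idealFiltration_pow_le (weightedFiltration (![s₃, W', s] : Fin 3 → Q) ![1, 1, 2]) (2 * (e * p)) d₄
  rw [show 2 * (e * p) * d₄ = d₄ * (2 * (e * p)) by ring] at hle
  exact ⟨hle (Ideal.pow_mem_pow h0 d₄), hle (Ideal.pow_mem_pow h1 d₄), hle (Ideal.pow_mem_pow h2 d₄)⟩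

/-! ## `τ`-fixedness -/

include ht hs hY' hs₃ hW' in
/-- `τ N₄ = N₄`. -/
theorem d4m4_norm_fixed [NeZero p] [CharP Q p] (hp1 : p ≠ 1) :
    τ (∏ i : ZMod p, (W' + (i.val : Q) * (s ^ 2 * t * Y' * s₃))) = ∏ i : ZMod p, (W' + (i.val : Q) * (s ^ 2 * t * Y' * s₃)) :=
  prod_shift_fixed hp1 τ W' (s ^ 2 * t * Y' * s₃) hW' (by rw [map_mul, map_mul, map_mul, map_pow, hs, ht, hY', hs₃])

include ht hs hY' hs₃ hW' hU₀ hU₁ hU₂ in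
/-- **The cover is `τ`-fixed.** -/
theorem d4m4_y_fixed [NeZero p] [CharP Q p] (hp1 : p ≠ 1) :
    τ ((s₃ ^ (2 * (e * p)) * U₀) ^ d₄) = (s₃ ^ (2 * (e * p)) * U₀) ^ d₄ ∧
    τ (((∏ i : ZMod p, (W' + (i.val : Q) * (s ^ 2 * t * Y' * s₃))) ^ (2 * e) * U₁) ^ d₄) =
      ((∏ i : ZMod p, (W' + (i.val : Q) * (s ^ 2 * t * Y' * s₃))) ^ (2 * e) * U₁) ^ d₄ ∧
    τ ((s ^ (e * p) * U₂) ^ d₄) = (s ^ (e * p) * U₂) ^ d₄ := by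
  refine ⟨?_, ?_, ?_⟩
  · rw [map_pow, map_mul, map_pow, hs₃, hU₀]
  · rw [map_pow, map_mul, map_pow, d4m4_norm_fixed τ t s Y' W' s₃ ht hs hY' hs₃ hW' hp1, hU₁]
  · rw [map_pow, map_mul, map_pow, hs, hU₂]

/-! ## Degrees (abstract: the units `U_j` are chosen to make each `b_j` homogeneous of degree 0) -/

section Degrees

variable {ιd : Type} [AddCommGroup ιd] [DecidableEq ιd] (𝒜 : ιd → AddSubgroup Q) [GradedRing 𝒜] (θ : ιd)

/-- `N₄` has degree `p • θ` when `W′` and the shift `s²tY′s₃` have degree `θ`. -/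
theorem d4m4_norm_deg [NeZero p] (hW'd : W' ∈ 𝒜 θ) (hδd : s ^ 2 * t * Y' * s₃ ∈ 𝒜 θ) :
    (∏ i : ZMod p, (W' + (i.val : Q) * (s ^ 2 * t * Y' * s₃))) ∈ 𝒜 (p • θ) := by
  have hfac : ∀ i : ZMod p, W' + (i.val : Q) * (s ^ 2 * t * Y' * s₃) ∈ 𝒜 θ := by
    intro i
    refine add_mem hW'd ?_
    have hn : ((i.val : Q)) ∈ 𝒜 0 := SetLike.natCast_mem_graded _ _
    have := SetLike.mul_mem_graded hn hδd
    rwa [zero_add] at this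
  have h := SetLike.prod_mem_graded (A := 𝒜) (i := fun _ => θ) (g := fun i => W' + (i.val : Q) * (s ^ 2 * t * Y' * s₃))
    (F := Finset.univ) (fun i _ => hfac i)
  rwa [Finset.sum_const, Finset.card_univ, ZMod.card] at h

/-- **The cover has degree 0** (from the degree-0 hypotheses on `b₀, b₁, b₂`). -/
theorem d4m4_y_deg [NeZero p] (hb₀d : s₃ ^ (2 * (e * p)) * U₀ ∈ 𝒜 0)
    (hb₁d : (∏ i : ZMod p, (W' + (i.val : Q) * (s ^ 2 * t * Y' * s₃))) ^ (2 * e) * U₁ ∈ 𝒜 0) (hb₂d : s ^ (e * p) * U₂ ∈ 𝒜 0) :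
    (s₃ ^ (2 * (e * p)) * U₀) ^ d₄ ∈ 𝒜 0 ∧
    ((∏ i : ZMod p, (W' + (i.val : Q) * (s ^ 2 * t * Y' * s₃))) ^ (2 * e) * U₁) ^ d₄ ∈ 𝒜 0 ∧ (s ^ (e * p) * U₂) ^ d₄ ∈ 𝒜 0 := by
  refine ⟨?_, ?_, ?_⟩
  · have h := SetLike.pow_mem_graded d₄ hb₀d; rwa [smul_zero] at h
  · have h := SetLike.pow_mem_graded d₄ hb₁d; rwa [smul_zero] at h
  · have h := SetLike.pow_mem_graded d₄ hb₂d; rwa [smul_zero] at h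

end Degrees

/-! ## `hrad` in `R₄ = R^w(Q; s₃, W′, s)` -/

/-- `N₄·T^p = ∏ (W′T + i·s²tY′·(s₃T))` in `Q[T;T⁻¹]`. -/
theorem d4m4_norm_T [NeZero p] : LaurentPolynomial.C (∏ i : ZMod p, (W' + (i.val : Q) * (s ^ 2 * t * Y' * s₃))) * LaurentPolynomial.T (p : ℤ) =
    ∏ i : ZMod p, (LaurentPolynomial.C W' * LaurentPolynomial.T 1 +
      LaurentPolynomial.C ((i.val : Q) * (s ^ 2 * t * Y')) * (LaurentPolynomial.C s₃ * LaurentPolynomial.T 1)) := by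
  have hfac : ∀ i : ZMod p, LaurentPolynomial.C W' * LaurentPolynomial.T 1 +
      LaurentPolynomial.C ((i.val : Q) * (s ^ 2 * t * Y')) * (LaurentPolynomial.C s₃ * LaurentPolynomial.T 1) =
      LaurentPolynomial.C (W' + (i.val : Q) * (s ^ 2 * t * Y' * s₃)) * LaurentPolynomial.T 1 := by
    intro i
    simp only [map_add, map_mul, map_pow]
    ring
  simp_rw [hfac]
  rw [Finset.prod_mul_distrib, ← map_prod, Finset.prod_const, Finset.card_univ, ZMod.card, LaurentPolynomial.T_pow, mul_one]

/-- The raw cover elements as products in `R₄`: `(s₃T)^{2ep}·U₀ = b₀T^{2ep}`, `(∏(W′T + i s²tY′·s₃T))^{2e}·U₁ = b₁T^{2ep}`, `(sT²)^{ep}·U₂ = b₂T^{2ep}`. -/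
theorem d4m4_raw_coe [NeZero p] :
    (((cobordantAlgebra.u' (![s₃, W', s] : Fin 3 → Q) ![1, 1, 2] 0 ^ (2 * (e * p)) * algebraMap Q _ U₀ :
        ↥(cobordantAlgebra (![s₃, W', s] : Fin 3 → Q) ![1, 1, 2])) : Q[T;T⁻¹]) =
      LaurentPolynomial.C (s₃ ^ (2 * (e * p)) * U₀) * LaurentPolynomial.T (((2 * (e * p)) : ℕ) : ℤ)) ∧
    ((((∏ i : ZMod p, (cobordantAlgebra.u' (![s₃, W', s] : Fin 3 → Q) ![1, 1, 2] 1 +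
        algebraMap Q _ ((i.val : Q) * (s ^ 2 * t * Y')) * cobordantAlgebra.u' (![s₃, W', s] : Fin 3 → Q) ![1, 1, 2] 0)) ^ (2 * e) * algebraMap Q _ U₁ :
        ↥(cobordantAlgebra (![s₃, W', s] : Fin 3 → Q) ![1, 1, 2])) : Q[T;T⁻¹]) =
      LaurentPolynomial.C ((∏ i : ZMod p, (W' + (i.val : Q) * (s ^ 2 * t * Y' * s₃))) ^ (2 * e) * U₁) * LaurentPolynomial.T (((2 * (e * p)) : ℕ) : ℤ)) ∧
    (((cobordantAlgebra.u' (![s₃, W', s] : Fin 3 → Q) ![1, 1, 2] 2 ^ (e * p) * algebraMap Q _ U₂ :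
        ↥(cobordantAlgebra (![s₃, W', s] : Fin 3 → Q) ![1, 1, 2])) : Q[T;T⁻¹]) =
      LaurentPolynomial.C (s ^ (e * p) * U₂) * LaurentPolynomial.T (((2 * (e * p)) : ℕ) : ℤ)) := by
  refine ⟨?_, ?_, ?_⟩
  · rw [MulMemClass.coe_mul, SubmonoidClass.coe_pow, cobordantAlgebra.coe_u', cobordantAlgebra.coe_algebraMap]
    change (LaurentPolynomial.C s₃ * LaurentPolynomial.T ((1 : ℕ) : ℤ)) ^ (2 * (e * p)) * LaurentPolynomial.C U₀ = _
    rw [mul_pow, ← map_pow, LaurentPolynomial.T_pow, map_mul (LaurentPolynomial.C) (s₃ ^ (2 * (e * p))),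
      show (((2 * (e * p)) : ℕ) : ℤ) * ((1 : ℕ) : ℤ) = (((2 * (e * p)) : ℕ) : ℤ) by push_cast; ring]
    ring
  · rw [MulMemClass.coe_mul, SubmonoidClass.coe_pow, SubmonoidClass.coe_finsetProd, cobordantAlgebra.coe_algebraMap]
    have hj : ∀ i : ZMod p, ((cobordantAlgebra.u' (![s₃, W', s] : Fin 3 → Q) ![1, 1, 2] 1 +
        algebraMap Q _ ((i.val : Q) * (s ^ 2 * t * Y')) * cobordantAlgebra.u' (![s₃, W', s] : Fin 3 → Q) ![1, 1, 2] 0 :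
        ↥(cobordantAlgebra (![s₃, W', s] : Fin 3 → Q) ![1, 1, 2])) : Q[T;T⁻¹]) =
        LaurentPolynomial.C W' * LaurentPolynomial.T 1 + LaurentPolynomial.C ((i.val : Q) * (s ^ 2 * t * Y')) * (LaurentPolynomial.C s₃ * LaurentPolynomial.T 1) := by
      intro i
      rw [AddMemClass.coe_add, MulMemClass.coe_mul, cobordantAlgebra.coe_u', cobordantAlgebra.coe_u', cobordantAlgebra.coe_algebraMap]
      rfl
    simp_rw [hj]
    rw [← d4m4_norm_T t s Y' W' s₃ (p := p), mul_pow, ← map_pow, LaurentPolynomial.T_pow, map_mul (LaurentPolynomial.C) _ U₁,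
      show ((((2 * e : ℕ) : ℤ)) * (p : ℤ)) = (((2 * (e * p)) : ℕ) : ℤ) by push_cast; ring]
    ring
  · rw [MulMemClass.coe_mul, SubmonoidClass.coe_pow, cobordantAlgebra.coe_u', cobordantAlgebra.coe_algebraMap]
    change (LaurentPolynomial.C s * LaurentPolynomial.T ((2 : ℕ) : ℤ)) ^ (e * p) * LaurentPolynomial.C U₂ = _
    rw [mul_pow, ← map_pow, LaurentPolynomial.T_pow, map_mul (LaurentPolynomial.C) (s ^ (e * p)),
      show (((e * p) : ℕ) : ℤ) * ((2 : ℕ) : ℤ) = (((2 * (e * p)) : ℕ) : ℤ) by push_cast; ring]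
    ring

/-- ★ **`hrad` for move 4**: with `U₀, U₁, U₂` units, the generators `s₃T, W′T, sT²` of the irrelevant ideal of `R₄` lie in `√(c₀, c₁, c₂)` for the cover
`c_j = y_jT^{d₄·2ep}`. [OURS · L1 W4.5c · D₄ move 4] -/
theorem d4m4_hrad [NeZero p] (hU₀u : IsUnit U₀) (hU₁u : IsUnit U₁) (hU₂u : IsUnit U₂)
    (c₀ c₁ c₂ : ↥(cobordantAlgebra (![s₃, W', s] : Fin 3 → Q) ![1, 1, 2]))
    (hc₀ : (c₀ : Q[T;T⁻¹]) = LaurentPolynomial.C ((s₃ ^ (2 * (e * p)) * U₀) ^ d₄) * LaurentPolynomial.T (((d₄ * (2 * (e * p))) : ℕ) : ℤ))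
    (hc₁ : (c₁ : Q[T;T⁻¹]) = LaurentPolynomial.C (((∏ i : ZMod p, (W' + (i.val : Q) * (s ^ 2 * t * Y' * s₃))) ^ (2 * e) * U₁) ^ d₄) *
      LaurentPolynomial.T (((d₄ * (2 * (e * p))) : ℕ) : ℤ))
    (hc₂ : (c₂ : Q[T;T⁻¹]) = LaurentPolynomial.C ((s ^ (e * p) * U₂) ^ d₄) * LaurentPolynomial.T (((d₄ * (2 * (e * p))) : ℕ) : ℤ)) (i : Fin 3) :
    cobordantAlgebra.u' (![s₃, W', s] : Fin 3 → Q) ![1, 1, 2] i ∈ (Ideal.span ({c₀, c₁, c₂} : Set ↥(cobordantAlgebra (![s₃, W', s] : Fin 3 → Q) ![1, 1, 2]))).radical := by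
  set A := cobordantAlgebra.u' (![s₃, W', s] : Fin 3 → Q) ![1, 1, 2] 0 with hAdef
  set B := cobordantAlgebra.u' (![s₃, W', s] : Fin 3 → Q) ![1, 1, 2] 1 with hBdef
  set C := cobordantAlgebra.u' (![s₃, W', s] : Fin 3 → Q) ![1, 1, 2] 2 with hCdef
  obtain ⟨e0, e1, e2⟩ := d4m4_raw_coe t s Y' W' s₃ U₀ U₁ U₂ (p := p) e
  have hA : (A ^ (2 * (e * p)) * algebraMap Q _ U₀) ^ d₄ = c₀ := by
    refine Subtype.ext ?_
    rw [SubmonoidClass.coe_pow, e0, hc₀, mul_pow, ← map_pow, LaurentPolynomial.T_pow]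
    congr 2
  have hC : (C ^ (e * p) * algebraMap Q _ U₂) ^ d₄ = c₂ := by
    refine Subtype.ext ?_
    rw [SubmonoidClass.coe_pow, e2, hc₂, mul_pow, ← map_pow, LaurentPolynomial.T_pow]
    congr 2
  have hB : ((∏ i : ZMod p, (B + algebraMap Q _ ((i.val : Q) * (s ^ 2 * t * Y')) * A)) ^ (2 * e) * algebraMap Q _ U₁) ^ d₄ = c₁ := by
    refine Subtype.ext ?_
    rw [SubmonoidClass.coe_pow, e1, hc₁, mul_pow, ← map_pow, LaurentPolynomial.T_pow]
    congr 2
  have hunit : ∀ {x : Q} (_ : IsUnit x) {z c : ↥(cobordantAlgebra (![s₃, W', s] : Fin 3 → Q) ![1, 1, 2])}, z * algebraMap Q _ x = c →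
      c ∈ (Ideal.span ({c₀, c₁, c₂} : Set ↥(cobordantAlgebra (![s₃, W', s] : Fin 3 → Q) ![1, 1, 2]))) →
      z ∈ (Ideal.span ({c₀, c₁, c₂} : Set ↥(cobordantAlgebra (![s₃, W', s] : Fin 3 → Q) ![1, 1, 2]))) := by
    intro x hx z c hzc hc
    obtain ⟨u, hu⟩ := hx.map (algebraMap Q ↥(cobordantAlgebra (![s₃, W', s] : Fin 3 → Q) ![1, 1, 2]))
    have hz : z = c * ↑u⁻¹ := by rw [← hzc, ← hu, Units.mul_inv_cancel_right]
    rw [hz]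
    exact Ideal.mul_mem_right _ _ hc
  have hc₀mem : c₀ ∈ Ideal.span ({c₀, c₁, c₂} : Set ↥(cobordantAlgebra (![s₃, W', s] : Fin 3 → Q) ![1, 1, 2])) := Ideal.subset_span (by simp)
  have hc₁mem : c₁ ∈ Ideal.span ({c₀, c₁, c₂} : Set ↥(cobordantAlgebra (![s₃, W', s] : Fin 3 → Q) ![1, 1, 2])) := Ideal.subset_span (by simp)
  have hc₂mem : c₂ ∈ Ideal.span ({c₀, c₁, c₂} : Set ↥(cobordantAlgebra (![s₃, W', s] : Fin 3 → Q) ![1, 1, 2])) := Ideal.subset_span (by simp)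
  have hArad : A ∈ (Ideal.span ({c₀, c₁, c₂} : Set ↥(cobordantAlgebra (![s₃, W', s] : Fin 3 → Q) ![1, 1, 2]))).radical := by
    refine ⟨2 * (e * p) * d₄, ?_⟩
    refine hunit (hU₀u.pow d₄) ?_ hc₀mem
    rw [pow_mul, map_pow, ← mul_pow, hA]
  have hCrad : C ∈ (Ideal.span ({c₀, c₁, c₂} : Set ↥(cobordantAlgebra (![s₃, W', s] : Fin 3 → Q) ![1, 1, 2]))).radical := by
    refine ⟨e * p * d₄, ?_⟩
    refine hunit (hU₂u.pow d₄) ?_ hc₂mem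
    rw [pow_mul, map_pow, ← mul_pow, hC]
  fin_cases i
  · exact hArad
  · change B ∈ _
    have hP : (∏ i : ZMod p, (B + algebraMap Q _ ((i.val : Q) * (s ^ 2 * t * Y')) * A)) ∈
        (Ideal.span ({c₀, c₁, c₂} : Set ↥(cobordantAlgebra (![s₃, W', s] : Fin 3 → Q) ![1, 1, 2]))).radical := by
      refine ⟨2 * e * d₄, ?_⟩
      refine hunit (hU₁u.pow d₄) ?_ hc₁mem
      rw [pow_mul, map_pow, ← mul_pow, hB]
    have hdiff : (∏ i : ZMod p, (B + algebraMap Q _ ((i.val : Q) * (s ^ 2 * t * Y')) * A)) - B ^ p ∈ Ideal.span {A} :=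
      prod_add_mul_sub_pow_mem B A fun i => algebraMap Q _ ((i.val : Q) * (s ^ 2 * t * Y'))
    have hBp : B ^ p ∈ (Ideal.span ({c₀, c₁, c₂} : Set ↥(cobordantAlgebra (![s₃, W', s] : Fin 3 → Q) ![1, 1, 2]))).radical := by
      have h2 := (Ideal.span_singleton_le_iff_mem _ |>.mpr hArad) hdiff
      have := sub_mem hP h2
      rwa [sub_sub_cancel] at this
    exact Ideal.mem_radical_of_pow_mem hBp
  · exact hCrad

end Summit.ResolutionOfSingularities.ResolutionOfSingularities.Theorems.WildQuotientResolution.S1.KillCert.D4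

end
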